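import Summits.ResolutionOfSingularities.ResolutionOfSingularities.Theorems.EquisingularLiftEquisingularLiftNatNDRoundModelSplit
import Summits.ResolutionOfSingularities.ResolutionOfSingularities.Theorems.EquisingularLiftEquisingularLiftNatNDLinkedStalksEnd
import HarnessLib

/-!
# [OURS · L1 W4.5(b) · EL♮(3)] ND-K5 (B4β2) `ND.transportEnd` — ASCENT AT THE END, BY NAME

OURS · L1 W4.5(b) · EL♮(3) stmt-ResolutionOfSingularities-20148 (parent EL♮ stmt-…-20038) · counted 0 · AI-written (res-L1-w45b-iso-w2 g0, WIDTH seat on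
D-0157 DOOR 1, desk WIDTH TABLE D1′ row iso-w2 = (B4β2)), weaker than expert review; nothing of [Hironaka2017] asserted; no statement of the manuscript;
resolution of singularities in positive characteristic is NOT proved here or by this.  Def-free, sorry-free, standard axioms.
`--supports stmt-ResolutionOfSingularities-20148 --as helper`.

WHAT.  The brick **(B4β2) `transportEnd (n) (k) [Field k] [IsAlgClosed k] : ND.TransportEnd n k`** of SPEC v11/v12 §13.15 (idea-1), BY NAME against the text
owner's port `…NatNDRoundModelSplit` (✓ p643982): an F-stage (`ND.FStage`) LINKED (`ND.Linked`) to a regular model TORIC stage (`ND.ToricStage`) with END over the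
origin is regular with END over `x`.  The residue field `κ(x) ⊇ k` is ARBITRARY (crit-3 R-T1; `κ(x) = k` is never assumed).

PROOF = unpack the three invariants and apply the raw-square glue: off `x` the F-stage is isomorphic to `F₁` (`FStage`'s `IsIso (φF ∣_ {x}ᶜ)`, tree
`isIso_stalkMap_of_isIso_morphismRestrict`); over `x` the pointwise A-side glue `ND.isRegularLocalRing_stalk_of_isPullback_frameBaseMap` through the
stalk isomorphism of `Linked`'s first square (`ND.exists_preimage_of_isPullback_fromSpecStalk`, `ND.isIso_stalkMap_of_isPullback_fromSpecStalk`, ✓ p644778)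
and END by `ND.isRegularLocalRing_stalk_subscheme_of_linked` (file `…NatNDLinkedStalksEnd`); the affine finite-type chart at every point of the model comes from
`ToricStage`'s toric charts `c : 𝔸ⁿ_k ⟶ A`, `c ≫ φA = Spec (toricChartHom B)` (`finiteType_chart_of_toricStage`: `Γ(A, c(𝔸ⁿ)) ≅ Γ(𝔸ⁿ, ⊤)` by `Scheme.Hom.appIso`,
`toricChartHom B ∘ C = C` so `toricChartHom B` is of finite type).  Underneath: `ND.flat_frameChart` ✓ p642337 and the ring-level core ✓ p643619 (Stacks 0381).
-/

set_option linter.dupNamespace false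

open CategoryTheory CategoryTheory.Limits AlgebraicGeometry TopologicalSpace Topology
open MvPolynomial TensorProduct
open Literature.AlgebraicGeometry.Resolution
open AlgebraicGeometry.Scheme.IdealSheafData

namespace Summit.ResolutionOfSingularities.ResolutionOfSingularities.Cruxes.EquisingularLiftNat.Sections.ND

/-- The toric chart map `toricChartHom B : k[X] → k[y]` is of finite type (it is a `k`-algebra map and `k[y]` is of finite type over `k`). [OURS · plumbing] -/
theorem finiteType_toricChartHom (n : ℕ) (k : Type) [Field k] (B : Fin n → Fin n → ℕ) : (toricChartHom n k B).FiniteType := by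
  refine RingHom.FiniteType.of_comp_finiteType (f := algebraMap k (MvPolynomial (Fin n) k)) ?_
  have h : (toricChartHom n k B).comp (algebraMap k (MvPolynomial (Fin n) k)) = algebraMap k (MvPolynomial (Fin n) k) := by
    ext a
    simp [toricChartHom]
  rw [h]
  exact RingHom.finiteType_algebraMap.mpr inferInstance

/-- **The chart hypothesis of the raw-square glue, from a toric chart.**  If `c : 𝔸ⁿ_k ⟶ A` is an open immersion with `c ≫ φA = Spec (toricChartHom B)`, then the
affine open `c(𝔸ⁿ_k) ∋ z` has coordinate ring of finite type over `k[X]` through `φA`. [OURS · plumbing] -/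
theorem finiteType_chart_of_toricStage (n : ℕ) (k : Type) [Field k] {A : Scheme.{0}} (φA : A ⟶ Aff n k)
    (B : Fin n → Fin n → ℕ) (c : Aff n k ⟶ A) [IsOpenImmersion c]
    (hc : c ≫ φA = Spec.map (CommRingCat.ofHom (toricChartHom n k B))) :
    ((φA.appLE ⊤ (c ''ᵁ ⊤) le_top).hom.comp (Scheme.ΓSpecIso (.of (MvPolynomial (Fin n) k))).inv.hom).FiniteType := by
  -- the composite `k[X] → Γ(A, c(𝔸ⁿ)) ≅ Γ(𝔸ⁿ, ⊤)` is `ΓSpecIso⁻¹ ∘ toricChartHom B`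
  have key : ∀ (f : Aff n k ⟶ Aff n k), f = Spec.map (CommRingCat.ofHom (toricChartHom n k B)) →
      ((f.appLE ⊤ ⊤ (by simp)).hom.comp (Scheme.ΓSpecIso (.of (MvPolynomial (Fin n) k))).inv.hom).FiniteType := by
    rintro f rfl
    have h1 : (Scheme.ΓSpecIso (.of (MvPolynomial (Fin n) k))).inv ≫
        (Spec.map (CommRingCat.ofHom (toricChartHom n k B))).appLE ⊤ ⊤ (by simp) =
        CommRingCat.ofHom (toricChartHom n k B) ≫ (Scheme.ΓSpecIso (.of (MvPolynomial (Fin n) k))).inv := by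
      rw [Scheme.Hom.appLE]
      simp only [Opens.map_top, homOfLE_refl, op_id, CategoryTheory.Functor.map_id, Category.comp_id]
      exact (Scheme.ΓSpecIso_inv_naturality (CommRingCat.ofHom (toricChartHom n k B))).symm
    have h2 : ((Spec.map (CommRingCat.ofHom (toricChartHom n k B))).appLE ⊤ ⊤ (by simp)).hom.comp
        (Scheme.ΓSpecIso (.of (MvPolynomial (Fin n) k))).inv.hom =
        (Scheme.ΓSpecIso (.of (MvPolynomial (Fin n) k))).inv.hom.comp (toricChartHom n k B) := by
      have h1' := congrArg (fun g => CommRingCat.Hom.hom g) h1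
      simp only [CommRingCat.hom_comp, CommRingCat.hom_ofHom] at h1'
      exact h1'
    rw [h2]
    exact (RingHom.FiniteType.of_surjective _ (Scheme.ΓSpecIso (.of (MvPolynomial (Fin n) k))).symm.commRingCatIsoToRingEquiv.surjective).comp
      (finiteType_toricChartHom n k B)
  -- `φA.appLE ⊤ (c(𝔸ⁿ)) ≫ (c.appIso ⊤).hom = (c ≫ φA).appLE ⊤ ⊤`
  have h3 : φA.appLE ⊤ (c ''ᵁ ⊤) le_top ≫ (c.appIso ⊤).hom = (c ≫ φA).appLE ⊤ ⊤ (by simp) := by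
    rw [Scheme.Hom.appIso_hom', Scheme.Hom.appLE_comp_appLE]
  have h4 : (φA.appLE ⊤ (c ''ᵁ ⊤) le_top).hom =
      (c.appIso ⊤).inv.hom.comp (((c ≫ φA).appLE ⊤ ⊤ (by simp)).hom) := by
    rw [← CommRingCat.hom_comp, ← h3, Category.assoc, Iso.hom_inv_id, Category.comp_id]
  rw [h4, RingHom.comp_assoc]
  exact (key (c ≫ φA) hc).comp_surjective (c.appIso ⊤).symm.commRingCatIsoToRingEquiv.surjective

/-- **(B4β2) `transportEnd`** — ASCENT AT THE END (SPEC v11/v12 §13.15, signature `ND.TransportEnd n k` of `…NatNDRoundModelSplit` VERBATIM): an F-stage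
linked to a regular model toric stage with END over the origin is regular with END over `x`.  [OURS · L1 W4.5b · ND-K5 (B4β2) · BY NAME] -/
theorem transportEnd (n : ℕ) (k : Type) [Field k] [IsAlgClosed k] : TransportEnd n k := by
  intro F₁ ρ T₁ hF₁reg hLN hT₁ x hx W w g h1 h2 h3 h4 h5 F φF EF TF A φA EA TA hFS hL hTS hAreg hend
  classical
  haveI := hLN
  obtain ⟨hLNF, hiso, hTFoff, hTFcl, hEF⟩ := hFS
  obtain ⟨L, a, b, c, sqF, sqA, hE, hT⟩ := hL
  obtain ⟨Φ, hsmooth, hcharts, hisoA, hTAoff, hTAcl, hEA⟩ := hTS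
  have sqA' : IsPullback b c φA (Spec.map (CommRingCat.ofHom (MvPolynomial.eval₂Hom (baseToStalk n k ρ x) w))) := sqA
  -- the affine finite-type chart at every point of the model
  have hchartA : ∀ z : A, ∃ U : A.Opens, z ∈ U ∧ IsAffineOpen U ∧
      ((φA.appLE ⊤ U le_top).hom.comp (Scheme.ΓSpecIso (.of (MvPolynomial (Fin n) k))).inv.hom).FiniteType := by
    intro z
    obtain ⟨σ, -, B, cA, hcA, hzc, -, -, hcomp, -, -, -⟩ := hcharts z
    haveI := hcA
    refine ⟨cA ''ᵁ ⊤, ?_, (isAffineOpen_top (Aff n k)).image_of_isOpenImmersion cA, finiteType_chart_of_toricStage n k φA B cA hcomp⟩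
    rw [Scheme.Hom.image_top_eq_opensRange]
    exact hzc
  refine ⟨?_, ?_⟩
  · -- regularity of the F-stage
    intro y
    by_cases hy : φF y = x
    · obtain ⟨ℓ, rfl, hℓ⟩ := exists_preimage_of_isPullback_fromSpecStalk x sqF y hy
      haveI := isIso_stalkMap_of_isPullback_fromSpecStalk x sqF ℓ
      have hLreg : IsRegularLocalRing (L.presheaf.stalk ℓ) :=
        isRegularLocalRing_stalk_of_isPullback_frameBaseMap n k ρ x w h2 h3 b c φA sqA' ℓ hℓ (hAreg (b ℓ)) (hchartA (b ℓ))
      exact IsRegularLocalRing.of_ringEquiv (asIso (a.stalkMap ℓ)).commRingCatIsoToRingEquiv.symm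
    · haveI := hiso
      haveI := isIso_stalkMap_of_isIso_morphismRestrict φF (⟨{x}ᶜ, hx.isOpen_compl⟩ : F₁.Opens) y hy
      haveI := hF₁reg (φF y)
      exact IsRegularLocalRing.of_ringEquiv (asIso (φF.stalkMap y)).commRingCatIsoToRingEquiv
  · -- END over `x`
    intro z hz
    refine isRegularLocalRing_stalk_subscheme_of_linked n k ρ x w h2 h3 a b c φF φA sqF sqA'
      (vanishingIdeal (⟨closure TF, isClosed_closure⟩ : Closeds F)) (vanishingIdeal (⟨closure TA, isClosed_closure⟩ : Closeds A)) ?_ ?_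
      (fun z' _ => hchartA z') hend z hz
    · have hs : (vanishingIdeal (⟨closure TF, isClosed_closure⟩ : Closeds F)).support = ⟨closure TF, isClosed_closure⟩ :=
        TopologicalSpace.Closeds.ext (Scheme.IdealSheafData.coe_support_vanishingIdeal _)
      rw [← Scheme.IdealSheafData.vanishingIdeal_support, hs]
    · rw [Scheme.IdealSheafData.coe_support_vanishingIdeal, Scheme.IdealSheafData.coe_support_vanishingIdeal]
      change a ⁻¹' closure TF = b ⁻¹' closure TA
      rw [hTFcl.closure_eq, hTAcl.closure_eq, hT]

end Summit.ResolutionOfSingularities.ResolutionOfSingularities.Cruxes.EquisingularLiftNat.Sections.ND
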